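import Summits.FinalStateConjecture.FinalStateConjecture.Theses.EIHFluxBalance
import Summits.FinalStateConjecture.FinalStateConjecture.Theorems.EIHFluxBalanceModulatedKerrHandoffTameCore
import Literature.Geometry.Lorentzian.TameFamilyFarSurgery
import Literature.Geometry.Lorentzian.TameFamilyOffCompact
import Literature.Geometry.Lorentzian.InitialDataPatch
import Literature.Geometry.Lorentzian.AdmissibleDataLocality
import Literature.Geometry.Lorentzian.InitialDataLocality
import Literature.Geometry.Lorentzian.AFEndPatch
import HarnessLib

/-!
# Line `trim-kick-censorship` — crux-strategist DECOMPOSITION skeleton for the crux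
# `EIHFluxBalance.ModulatedKerrHandoff` (item stmt-FinalStateConjecture-17402, H′ = the TAME re-type)

Strategist `planner-cstrat-stmt-FinalStateConjecture-17402-r1-0`, 2026-08-17 (EXEMPT-46 re-exam fix:
the lead's line `Sketch` reduced the crux to ONE stub `stub_tameEscapeExists`, kernel-equivalent to the
crux; this line cuts that stub along the cards' mechanism — tame-template's
`SmoothKerrEndTrimming ⊕ CoreKickGenericity` with the core-kick genericity further cut at the classical
censorship seam — into THREE registered stubs none of which is a tame-genericity statement of
`HandoffPropT`, with the composition into the crux PROVED here, sorry-free outside the stubs).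

## Stubs (= the route's new leaves after `route edit --split ModulatedKerrHandoff`)

* `stub_tameEndTrimming` (piece T, `TameEndTrimming`; constraint gluing, L): every admissible datum,
  read on a sole Dafermos–Rodnianski end `e`, carries a TAME TRIMMING FAMILY `R ↦ T R` beyond some
  `R₀` (`IsTameTrimmingFamily`: `T R` admissible, trimmed to `o₄(r^{-15/8}) / o₃(r^{-23/8})` on `e`,
  DR-flat with a continuous mass `M R → M₀`, equal to `d` off `e.far R`, jointly smooth along smooth
  radius schedules, and `e.wDist (T R) d → 0`). Corvino–Schoen 2006 Thms 1–2 / Chruściel–Delay 2003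
  made parametric in the radius (Mao–Oh–Tao solution operators); NOT in print in this tame form.
* `stub_kickCensorship` (piece W, `KickCensorship`; open problem = weak cosmic censorship in
  Christodoulou's local one-sided form): through every admissible datum some MGHD of which has
  incomplete `𝓘⁺` passes a LOCAL KICK FAMILY (jointly smooth, through `d`, admissible, agreeing with
  `d` off one compact set — the `Local` legend of route LateLocalKicks verbatim) whose members with
  `0 < c₀ < δ` have complete `𝓘⁺` in every MGHD.
* `stub_censoredKickHandoff` (piece K, `CensoredKickHandoff`; open problem = capture into receding
  sub-extremal Kerr basins + far-surgery stability + format synthesis, for CENSORED kick lines; no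
  censorship content, no genericity quantifier over `HandoffPropT`): for an `H′`-exceptional admissible
  `d`, a local kick family `G₁` through `d` with censored small positive members (the constant family
  when `d` itself is censored), and a tame trimming family `T` of `d`: there are a local kick family
  `G` through `d`, `δ > 0` and a threshold `ρ₁` bounded on compact subintervals of `(0, δ)` such that
  for `0 < c₀ < δ` and every `R ≥ max R₀ (ρ₁ c₀)`, EVERY admissible datum having the sections of `G c`
  off `e.far R` and those of `T R` on `e.far R` admits a maximal vacuum Cauchy development with the
  handoff clause (`HandoffClause`: complete `𝓘⁺` + the modulated multi-Kerr–Schild ansatz with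
  (T), (O), (R), (QS)).

## Composition (PROVED): `ModulatedKerrHandoff_of`

`exists_tameCurve_of_kick_trim` builds, from a kick leg and a trim leg, the TAME curve
`F c = (T (ρ c₀)) patched by (G c) on the core` (`c₀ > 0`; `= G c` for `c₀ ≤ 0`) along a smooth
receding schedule `ρ ≥ ρ₁, R₀, R_K` (`exists_schedule`: smooth partitions of unity on `ℝ` dominate the
locally bounded threshold read in `τ = 1/s`), and proves: joint smoothness (local — near core points the
family is `G`, near far points `c ↦ T (ρ̃ c₀)` for a global smooth modification `ρ̃` of the schedule,
`exists_contDiff_extension_Ici`; `isSmoothDataFamily_of_locally_eq`); TAMENESS on the collar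
`e.restrict (e.R + 1)` (`IsTameDataFamily.of_wDist_tendsto` over the tame kick family,
`isTameDataFamily_restrict_of_agree_off_compact_one`, with `wDist (F c) (G c) = wDist (T (ρ c₀)) d → 0`
by `wDist_eq_of_forall` and continuity of the patched mass `c ↦ M (ρ c₀)`); admissibility of the
members (locality of the vacuum constraints, `isVacuumAt_congr`, `mem_admissibleVacuumData_of_agree_off_compact`).
`tameEscapeExists_of_trim_kick` runs it through the censorship case split (constant censored family or
piece W's), and the landed `modulatedKerrHandoff_of_tameEscapeExists` (`…TameCore.lean`, p136820)
concludes the crux BY NAME. Probes: each piece → Statement and → crux by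
`first | exact? | simpa | aesop` FAIL (folder `bc/`, 6/6, heartbeat exhaustion); no landed iff.

Disproof used: tree `Disproof.lean` gen 3 (§4 constraints / `IsMaximal` load-bearing — every member is a
constraint-solving admissible datum, developments enter only through `HandoffClause` of ONE maximal
development; §11 receding-only families are not immersed — irrelevant here since the reduction
`modulatedKerrHandoff_of_tameEscapeExists` restores immersion by breathing; §14 transport lemmas landed).
-/

set_option linter.dupNamespace false

noncomputable section

namespace Summit.FinalStateConjecture.FinalStateConjecture.Cruxes.ModulatedKerrHandoff.TrimKickCensorship

open scoped Topology Manifold ContDiff ENNReal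
open Bundle Filter Set Function TopologicalSpace Literature.Geometry.Lorentzian InitialDataSet
open Summit.FinalStateConjecture.FinalStateConjecture.Theses.EIHFluxBalance
open Summit.FinalStateConjecture.FinalStateConjecture.Theorems.EIHFluxBalance.TameTemplate

/-! ### Vocabulary (also filed Theses-free as evidence `EIHFluxBalanceModulatedKerrHandoffTrimDefs.lean`) -/

/-- **Local kick family** through the datum `d` (verbatim the `Local` legend of route
LateLocalKicks): `G : ℝ¹ → data` jointly smooth (`IsSmoothDataFamily`), `G 0 = d`, every member
admissible, and ONE compact set `K ⊆ X` off which every member has the sections of `d`.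
Christodoulou's compactly supported witness lines `α₀ + c f`. [cite: Christodoulou1999, p. A24] -/
def IsLocalKick (X : Type) [TopologicalSpace X] [ChartedSpace E3 X]
    [IsManifold (𝓡 3) ∞ X] [T2Space X] [SecondCountableTopology X] [ConnectedSpace X]
    (d : InitialDataSet (𝓡 3) X) (G : EuclideanSpace ℝ (Fin 1) → InitialDataSet (𝓡 3) X) : Prop :=
  IsSmoothDataFamily 1 G ∧ G 0 = d ∧ (∀ c, G c ∈ admissibleVacuumData X) ∧
    ∃ K : Set X, IsCompact K ∧ ∀ c, ∀ x ∉ K, (G c).h.inner x = d.h.inner x ∧ (G c).k x = d.k x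

/-- **Trimmed datum on the end `e`**: Schwarzschildean in the chart of `e` to the orders the
far-field clauses of the handoff ansatz consume — `h − (1 + 2M/r)δ = o₄(r^{-15/8})`,
`k = o₃(r^{-23/8})`. Exact Kerr `t`-slice ends (Corvino–Schoen 2006, Thm 2) and harmonic
asymptotics (ibid., Thm 1: `O_∞(r⁻²)`, `O_∞(r⁻³)`) are trimmed. [cite: CorvinoSchoen2006, Thm 1] -/
def IsTrimmed {X : Type} [TopologicalSpace X] [ChartedSpace E3 X] [IsManifold (𝓡 3) ∞ X]
    (e : AFEnd X) (D : InitialDataSet (𝓡 3) X) : Prop :=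
  ∃ M : ℝ, e.IsStronglyAsymptoticallyFlatWith D M (15 / 8) (23 / 8) 4 3

/-- **Tame trimming family** of the datum `d` on the end `e` (mass `M₀`) beyond the radius `R₀`:
for every `R ≥ R₀` the datum `T R` is admissible, trimmed on `e`, Dafermos–Rodnianski flat on `e`
with mass `M R`, and has the sections of `d` at every point off the far region `e.far R`; the family
is jointly smooth along every smooth radius schedule `ρ ≥ R₀`; the mass function is continuous on
`[R₀, ∞)` with `M R → M₀`; and the trimming is TAME: `e.wDist (T R) d → 0` as `R → ∞` (the
Dafermos–Rodnianski weighted `C² × C¹` size of the surgery vanishes — what makes receding trimming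
compatible with `IsTameDataFamily`). Engines: Corvino–Schoen 2006 Thms 1–2, Chruściel–Delay 2003,
made parametric in the radius. [cite: CorvinoSchoen2006, Thm 1] [cite: DafermosRodnianski2013, App. B.2.3] -/
def IsTameTrimmingFamily (X : Type) [TopologicalSpace X] [ChartedSpace E3 X]
    [IsManifold (𝓡 3) ∞ X] [T2Space X] [SecondCountableTopology X] [ConnectedSpace X]
    (e : AFEnd X) (d : InitialDataSet (𝓡 3) X) (M₀ R₀ : ℝ) (T : ℝ → InitialDataSet (𝓡 3) X)
    (M : ℝ → ℝ) : Prop :=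
  (∀ R, R₀ ≤ R → T R ∈ admissibleVacuumData X ∧ IsTrimmed e (T R) ∧
      e.IsStronglyAsymptoticallyFlatDR (T R) (M R) ∧
        ∀ x ∉ e.far R, (T R).h.inner x = d.h.inner x ∧ (T R).k x = d.k x) ∧
    (∀ ρ : EuclideanSpace ℝ (Fin 1) → ℝ, ContDiff ℝ ∞ ρ → (∀ c, R₀ ≤ ρ c) →
      IsSmoothDataFamily 1 (fun c ↦ T (ρ c))) ∧
    ContinuousOn M (Set.Ici R₀) ∧ Tendsto M atTop (𝓝 M₀) ∧
      Tendsto (fun R ↦ e.wDist (T R) d) atTop (𝓝 0)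

/-! ### Real-analysis lemmas: smooth schedules -/

/-- A function `φ : ℝ → ℝ` that is locally bounded above is dominated by a smooth function
(smooth partitions of unity: Mathlib's `exists_contMDiffMap_forall_mem_convex_of_local_const` on
the manifold `ℝ` with the convex sets `[φ x, ∞)`). [folklore] -/
theorem exists_contDiff_ge_of_locally_bddAbove (φ : ℝ → ℝ)
    (hφ : ∀ x : ℝ, ∃ C : ℝ, ∀ᶠ y in 𝓝 x, φ y ≤ C) :
    ∃ g : ℝ → ℝ, ContDiff ℝ ∞ g ∧ ∀ x, φ x ≤ g x := by
  obtain ⟨g, hg⟩ := exists_contMDiffMap_forall_mem_convex_of_local_const (I := 𝓘(ℝ, ℝ)) (M := ℝ)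
    (F := ℝ) (n := (⊤ : ℕ∞)) (t := fun x ↦ Ici (φ x)) (fun x ↦ convex_Ici _) (fun x ↦ by
      obtain ⟨C, hC⟩ := hφ x
      exact ⟨C, hC.mono fun y hy ↦ hy⟩)
  exact ⟨g, contMDiff_iff_contDiff.1 g.contMDiff, fun x ↦ hg x⟩

/-- **Smooth receding schedule dominating a locally bounded threshold.** If `ρ₁ : ℝ → ℝ` is
locally bounded above on `(0, δ)`, then for every `A` there is `ρ : ℝ → ℝ`, smooth on `(0, ∞)`,
with `ρ ≥ A` on `(0, ∞)`, `ρ ≥ ρ₁` on `(0, δ/2)` and `ρ s → ∞` as `s → 0⁺` (dominate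
`τ ↦ |A| + |τ| + ρ₁(1/τ)⁺` by a smooth function of `τ = 1/s`). [folklore] -/
theorem exists_schedule {ρ₁ : ℝ → ℝ} {δ : ℝ} (hδ : 0 < δ)
    (hbd : ∀ s : ℝ, 0 < s → s < δ → ∃ C : ℝ, ∀ᶠ s' in 𝓝 s, ρ₁ s' ≤ C) (A : ℝ) :
    ∃ ρ : ℝ → ℝ, ContDiffOn ℝ ∞ ρ (Ioi 0) ∧ (∀ s, 0 < s → A ≤ ρ s) ∧
      (∀ s, 0 < s → s < δ / 2 → ρ₁ s ≤ ρ s) ∧ Tendsto ρ (𝓝[>] 0) atTop := by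
  classical
  -- the threshold read in the variable `τ = 1/s`, cut off below `τ = 2/δ`
  set ψ : ℝ → ℝ := fun τ ↦ if 2 / δ ≤ τ then max (ρ₁ (1 / τ)) 0 else 0 with hψ
  set φ : ℝ → ℝ := fun τ ↦ |A| + |τ| + ψ τ with hφ
  have hψ0 : ∀ τ, 0 ≤ ψ τ := fun τ ↦ by
    simp only [hψ]
    split_ifs
    · exact le_max_right _ _
    · exact le_rfl
  have hloc : ∀ x : ℝ, ∃ C : ℝ, ∀ᶠ y in 𝓝 x, φ y ≤ C := by
    intro τ₀
    -- local bound for `ψ`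
    have hψloc : ∃ C : ℝ, ∀ᶠ τ in 𝓝 τ₀, ψ τ ≤ C := by
      by_cases hτ : 2 / δ ≤ τ₀
      · have hτ₀ : 0 < τ₀ := lt_of_lt_of_le (by positivity) hτ
        have hs₀ : 0 < 1 / τ₀ := by positivity
        have hs₀' : 1 / τ₀ < δ := by
          rw [div_lt_iff₀ hτ₀]
          have : 2 / δ * δ ≤ τ₀ * δ := by nlinarith
          have h2 : 2 / δ * δ = 2 := by field_simp
          nlinarith
        obtain ⟨C, hC⟩ := hbd (1 / τ₀) hs₀ hs₀'
        have hcont : ContinuousAt (fun τ : ℝ ↦ 1 / τ) τ₀ :=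
          (continuousAt_const.div continuousAt_id hτ₀.ne')
        have hpull : ∀ᶠ τ in 𝓝 τ₀, ρ₁ (1 / τ) ≤ C := hcont.eventually hC
        refine ⟨max C 0, hpull.mono fun τ hτ' ↦ ?_⟩
        simp only [hψ]
        split_ifs
        · exact max_le_max hτ' le_rfl
        · exact le_max_right _ _
      · push_neg at hτ
        refine ⟨0, (eventually_lt_nhds hτ).mono fun τ hτ' ↦ ?_⟩
        simp only [hψ, if_neg (not_le.2 hτ')]
        exact le_rfl
    obtain ⟨C, hC⟩ := hψloc
    have habs : ∀ᶠ τ in 𝓝 τ₀, |τ| ≤ |τ₀| + 1 := by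
      have : ∀ᶠ τ in 𝓝 τ₀, dist τ τ₀ < 1 := Metric.ball_mem_nhds τ₀ one_pos
      refine this.mono fun τ hτ ↦ ?_
      rw [Real.dist_eq] at hτ
      have := abs_sub_abs_le_abs_sub τ τ₀
      linarith
    refine ⟨|A| + (|τ₀| + 1) + C, (hC.and habs).mono fun τ hτ ↦ ?_⟩
    simp only [hφ]
    linarith [hτ.1, hτ.2]
  obtain ⟨g, hg, hge⟩ := exists_contDiff_ge_of_locally_bddAbove φ hloc
  have hφge : ∀ s, 0 < s → |A| + 1 / s + ψ (1 / s) ≤ g (1 / s) := fun s hs ↦ by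
    have h := hge (1 / s)
    have : |1 / s| = 1 / s := abs_of_pos (by positivity)
    simp only [hφ, this] at h
    exact h
  refine ⟨fun s ↦ g (1 / s), ?_, ?_, ?_, ?_⟩
  · exact hg.comp_contDiffOn (contDiffOn_const.div contDiffOn_id fun x hx ↦ ne_of_gt hx)
  · intro s hs
    have h1 := hφge s hs
    have h2 : (0 : ℝ) ≤ 1 / s := by positivity
    have h3 := hψ0 (1 / s)
    have h4 : A ≤ |A| := le_abs_self A
    linarith
  · intro s hs hsδ
    have h1 := hφge s hs
    have h2 : (0 : ℝ) ≤ 1 / s := by positivity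
    have hcond : 2 / δ ≤ 1 / s := by
      rw [div_le_div_iff₀ hδ hs]
      linarith
    have h3 : ρ₁ s ≤ ψ (1 / s) := by
      simp only [hψ, if_pos hcond, one_div_one_div]
      exact le_max_left _ _
    have h4 : (0 : ℝ) ≤ |A| := abs_nonneg A
    linarith
  · have hev : ∀ᶠ s in 𝓝[>] (0 : ℝ), |A| + 1 / s ≤ g (1 / s) := by
      filter_upwards [self_mem_nhdsWithin] with s hs
      have h1 := hφge s hs
      linarith [hψ0 (1 / s)]
    refine tendsto_atTop_mono' _ hev ?_
    have h1 : Tendsto (fun s : ℝ ↦ 1 / s) (𝓝[>] 0) atTop := by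
      simpa only [one_div] using tendsto_inv_nhdsGT_zero (𝕜 := ℝ)
    exact tendsto_atTop_add_const_left _ _ h1

/-- **Smooth global modification of a function smooth on `(0, ∞)`**: given `ρ` smooth on `(0,∞)`
with `ρ ≥ A` there, and `a > 0`, there is a globally smooth `ρ' ≥ A` with `ρ' = ρ` on `[a, ∞)`
(cut off by `Real.smoothTransition` on `[a/2, a]`). [folklore] -/
theorem exists_contDiff_extension_Ici {ρ : ℝ → ℝ} {A a : ℝ} (hρ : ContDiffOn ℝ ∞ ρ (Ioi 0))
    (hA : ∀ s, 0 < s → A ≤ ρ s) (ha : 0 < a) :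
    ∃ ρ' : ℝ → ℝ, ContDiff ℝ ∞ ρ' ∧ (∀ s, A ≤ ρ' s) ∧ ∀ s, a ≤ s → ρ' s = ρ s := by
  set χ : ℝ → ℝ := fun s ↦ Real.smoothTransition ((s - a / 2) / (a / 2)) with hχ
  have hχ_smooth : ContDiff ℝ ∞ χ :=
    Real.smoothTransition.contDiff.comp ((contDiff_id.sub contDiff_const).div_const _)
  have hχ0 : ∀ s, s ≤ a / 2 → χ s = 0 := fun s hs ↦ by
    apply Real.smoothTransition.zero_of_nonpos
    apply div_nonpos_of_nonpos_of_nonneg <;> linarith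
  have hχ1 : ∀ s, a ≤ s → χ s = 1 := fun s hs ↦ by
    apply Real.smoothTransition.one_of_one_le
    rw [le_div_iff₀ (by positivity)]
    linarith
  have hχnn : ∀ s, 0 ≤ χ s := fun s ↦ Real.smoothTransition.nonneg _
  refine ⟨fun s ↦ A + χ s * (ρ s - A), ?_, ?_, ?_⟩
  · refine contDiff_iff_contDiffAt.2 fun s ↦ ?_
    by_cases hs : s < a / 2
    · have hev : (fun s ↦ A + χ s * (ρ s - A)) =ᶠ[𝓝 s] fun _ ↦ A := by
        filter_upwards [eventually_lt_nhds hs] with t ht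
        rw [hχ0 t ht.le, zero_mul, add_zero]
      exact (contDiffAt_const.congr_of_eventuallyEq hev)
    · push_neg at hs
      have hs0 : 0 < s := lt_of_lt_of_le (by positivity) hs
      have hρs : ContDiffAt ℝ ∞ ρ s := hρ.contDiffAt (Ioi_mem_nhds hs0)
      exact contDiffAt_const.add (hχ_smooth.contDiffAt.mul (hρs.sub contDiffAt_const))
  · intro s
    by_cases hs : 0 < s
    · have h1 : 0 ≤ χ s * (ρ s - A) := mul_nonneg (hχnn s) (by linarith [hA s hs])
      linarith
    · push_neg at hs
      have : χ s = 0 := hχ0 s (by linarith)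
      show A ≤ A + χ s * (ρ s - A)
      rw [this, zero_mul, add_zero]
  · intro s hs
    show A + χ s * (ρ s - A) = ρ s
    rw [hχ1 s hs, one_mul]
    ring

/-! ### Plumbing on one end: chart components of data agreeing pointwise -/

section End

variable {X : Type} [TopologicalSpace X] [ChartedSpace E3 X] [IsManifold (𝓡 3) ∞ X]

-- operator-norm instance paths on form-valued maps are slow to unify
set_option synthInstance.maxHeartbeats 400000 in
/-- If at EVERY point of `X` either (`D₁ = D₂` and `D₃ = D₄`) or (`D₁ = D₃` and `D₂ = D₄`) as
metrics, then the chart-component differences `hCoeff e D₁ − hCoeff e D₂` and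
`hCoeff e D₃ − hCoeff e D₄` are the same function on `E3` (junk values included). [folklore] -/
theorem hCoeff_sub_eq_of_forall (e : AFEnd X) {D₁ D₂ D₃ D₄ : InitialDataSet (𝓡 3) X}
    (h : ∀ x : X, (D₁.h.inner x = D₂.h.inner x ∧ D₃.h.inner x = D₄.h.inner x) ∨
      (D₁.h.inner x = D₃.h.inner x ∧ D₂.h.inner x = D₄.h.inner x)) :
    (fun z ↦ e.hCoeff D₁ z - e.hCoeff D₂ z) = fun z ↦ e.hCoeff D₃ z - e.hCoeff D₄ z := by
  funext z
  by_cases hz : e.R < ‖z‖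
  · have key : ∀ {A B : InitialDataSet (𝓡 3) X},
        A.h.inner (e.dataChart ⟨z, hz⟩) = B.h.inner (e.dataChart ⟨z, hz⟩) →
          e.hCoeff A z = e.hCoeff B z := fun hAB ↦ by
      simp only [AFEnd.hCoeff, dif_pos hz, pullbackBilin, hAB]
    rcases h (e.dataChart ⟨z, hz⟩) with ⟨h1, h2⟩ | ⟨h1, h2⟩
    · rw [key h1, key h2, sub_self (G := E3 →L[ℝ] E3 →L[ℝ] ℝ),
        sub_self (G := E3 →L[ℝ] E3 →L[ℝ] ℝ)]
    · rw [key h1, key h2]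
  · simp only [AFEnd.hCoeff, dif_neg hz]

-- operator-norm instance paths on form-valued maps are slow to unify
set_option synthInstance.maxHeartbeats 400000 in
/-- The same for the components of `k`. [folklore] -/
theorem kCoeff_sub_eq_of_forall (e : AFEnd X) {D₁ D₂ D₃ D₄ : InitialDataSet (𝓡 3) X}
    (h : ∀ x : X, (D₁.k x = D₂.k x ∧ D₃.k x = D₄.k x) ∨ (D₁.k x = D₃.k x ∧ D₂.k x = D₄.k x)) :
    (fun z ↦ e.kCoeff D₁ z - e.kCoeff D₂ z) = fun z ↦ e.kCoeff D₃ z - e.kCoeff D₄ z := by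
  funext z
  by_cases hz : e.R < ‖z‖
  · have key : ∀ {A B : InitialDataSet (𝓡 3) X},
        A.k (e.dataChart ⟨z, hz⟩) = B.k (e.dataChart ⟨z, hz⟩) → e.kCoeff A z = e.kCoeff B z :=
      fun hAB ↦ by
      simp only [AFEnd.kCoeff, dif_pos hz, pullbackBilin, hAB]
    rcases h (e.dataChart ⟨z, hz⟩) with ⟨h1, h2⟩ | ⟨h1, h2⟩
    · rw [key h1, key h2, sub_self (G := E3 →L[ℝ] E3 →L[ℝ] ℝ),
        sub_self (G := E3 →L[ℝ] E3 →L[ℝ] ℝ)]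
    · rw [key h1, key h2]
  · simp only [AFEnd.kCoeff, dif_neg hz]

/-- `wDist` only sees the chart-component differences: data agreeing pointwise in the pattern of
`hCoeff_sub_eq_of_forall` have the same weighted distance. [folklore] -/
theorem wDist_eq_of_forall (e : AFEnd X) {D₁ D₂ D₃ D₄ : InitialDataSet (𝓡 3) X}
    (h : ∀ x : X, ((D₁.h.inner x = D₂.h.inner x ∧ D₁.k x = D₂.k x) ∧
        (D₃.h.inner x = D₄.h.inner x ∧ D₃.k x = D₄.k x)) ∨
      ((D₁.h.inner x = D₃.h.inner x ∧ D₁.k x = D₃.k x) ∧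
        (D₂.h.inner x = D₄.h.inner x ∧ D₂.k x = D₄.k x))) :
    e.wDist D₁ D₂ = e.wDist D₃ D₄ := by
  have hh := hCoeff_sub_eq_of_forall e (D₁ := D₁) (D₂ := D₂) (D₃ := D₃) (D₄ := D₄) fun x ↦ by
    rcases h x with ⟨⟨a, -⟩, ⟨b, -⟩⟩ | ⟨⟨a, -⟩, ⟨b, -⟩⟩
    · exact Or.inl ⟨a, b⟩
    · exact Or.inr ⟨a, b⟩
  have hk := kCoeff_sub_eq_of_forall e (D₁ := D₁) (D₂ := D₂) (D₃ := D₃) (D₄ := D₄) fun x ↦ by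
    rcases h x with ⟨⟨-, a⟩, ⟨-, b⟩⟩ | ⟨⟨-, a⟩, ⟨-, b⟩⟩
    · exact Or.inl ⟨a, b⟩
    · exact Or.inr ⟨a, b⟩
  unfold AFEnd.wDist
  rw [hh, hk]

/-- The weighted distance on a collared end is at most that on the end (an `iSup` over a smaller
region of the same integrand, `AFEnd.wDist_restrict_eq`). [folklore] -/
theorem wDist_restrict_le (e : AFEnd X) {R₁ : ℝ} (hR₁ : e.R ≤ R₁) (D D' : InitialDataSet (𝓡 3) X) :
    (e.restrict hR₁).wDist D D' ≤ e.wDist D D' := by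
  rw [e.wDist_restrict_eq hR₁]
  unfold AFEnd.wDist
  gcongr with m hm x m hm x
  · exact iSup_le fun hx ↦ le_iSup_of_le (lt_of_le_of_lt hR₁ hx) le_rfl
  · exact iSup_le fun hx ↦ le_iSup_of_le (lt_of_le_of_lt hR₁ hx) le_rfl

end End

/-! ### The core construction: a local kick family patched with a receding tame trimming -/

section Core

variable {X : Type} [TopologicalSpace X] [ChartedSpace E3 X] [IsManifold (𝓡 3) ∞ X]
  [T2Space X] [SecondCountableTopology X] [ConnectedSpace X]

/-- **Patch data: the kicked core inside a trimmed datum.** For a datum `T` having the sections of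
`d` off a far region contained in `Wᶜ = closedFar Rb`, an open `W ⊇ K`, and a datum `Gc` having
the sections of `d` off the compact `K`, the sections of `Gc` on `W` are patch data for `T`
(`W ∖ K`: both are `d`). [cite: Corvino2000, §4] -/
theorem patchData_kick_trim (e : AFEnd X) {d T Gc : InitialDataSet (𝓡 3) X} {K : Set X}
    {Rb R : ℝ} (hRb : e.R < Rb) (hR : Rb ≤ R) (hK : IsCompact K)
    (hKW : K ⊆ (e.closedFar Rb)ᶜ)
    (hT : ∀ x ∉ e.far R, T.h.inner x = d.h.inner x ∧ T.k x = d.k x)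
    (hG : ∀ x ∉ K, Gc.h.inner x = d.h.inner x ∧ Gc.k x = d.k x) :
    T.PatchData (e.closedFar Rb)ᶜ K Gc.h.inner Gc.k where
  isOpen := (e.isClosed_closedFar hRb).isOpen_compl
  isClosed := hK.isClosed
  subset := hKW
  smooth_h := Gc.h.contMDiff.contMDiffOn
  smooth_k := Gc.contMDiff_k.contMDiffOn
  symm_h := fun x _ v w ↦ Gc.h.symm x v w
  pos_h := fun x _ v hv ↦ Gc.h.pos x v hv
  symm_k := fun x _ v w ↦ Gc.k_symm x v w
  agree_h := fun x hxW hxK ↦ by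
    have hxfar : x ∉ e.far R := fun hx ↦ hxW ((e.far_mono hR).trans (e.far_subset_closedFar Rb) hx)
    rw [(hG x hxK).1, (hT x hxfar).1]
  agree_k := fun x hxW hxK ↦ by
    have hxfar : x ∉ e.far R := fun hx ↦ hxW ((e.far_mono hR).trans (e.far_subset_closedFar Rb) hx)
    rw [(hG x hxK).2, (hT x hxfar).2]

/-- **TAME ESCAPE FROM A KICK LEG AND A TRIM LEG (the assembly's construction).** Let `d` be a datum
with sole Dafermos–Rodnianski end `e` (mass `M₀`), `T` a tame trimming family of `d` on `e` beyond
`R₀`, `G` a local kick family through `d`, and suppose a property `P` holds for every admissible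
datum which has the sections of `G c` off `e.far R` and those of `T R` on `e.far R`, whenever
`0 < c₀ < δ` and `R ≥ max R₀ (ρ₁ c₀)` for a threshold `ρ₁` locally bounded on `(0, δ)`. Then through
`d` passes a TAME curve of admissible data (on a collar of `e`) whose members with small `c₀ > 0`
satisfy `P`: the members are `T (ρ c₀)` patched by `G c` on the core, along a smooth receding
schedule `ρ ≥ ρ₁` (`exists_schedule`); joint smoothness is local (`isSmoothDataFamily_of_locally_eq`:
near core points the family is `G`, near far points it is `c ↦ T (ρ c₀)`), tameness is
`IsTameDataFamily.of_wDist_tendsto` over the tame kick family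
(`isTameDataFamily_restrict_of_agree_off_compact_one`) with `wDist (F c) (G c) = wDist (T (ρ c₀)) d → 0`,
admissibility is locality of the constraints. [cite: Christodoulou1999, p. A24] -/
theorem exists_tameCurve_of_kick_trim (d : InitialDataSet (𝓡 3) X) (e : AFEnd X) (M₀ R₀ : ℝ)
    (T : ℝ → InitialDataSet (𝓡 3) X) (M : ℝ → ℝ) (hsole : e.IsSoleEnd)
    (hDR : e.IsStronglyAsymptoticallyFlatDR d M₀) (hT : IsTameTrimmingFamily X e d M₀ R₀ T M)
    (G : EuclideanSpace ℝ (Fin 1) → InitialDataSet (𝓡 3) X) (hG : IsLocalKick X d G)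
    {δ : ℝ} {ρ₁ : ℝ → ℝ} (hδ : 0 < δ)
    (hbd : ∀ s : ℝ, 0 < s → s < δ → ∃ C : ℝ, ∀ᶠ s' in 𝓝 s, ρ₁ s' ≤ C)
    (P : InitialDataSet (𝓡 3) X → Prop)
    (hgood : ∀ c : EuclideanSpace ℝ (Fin 1), 0 < c 0 → c 0 < δ → ∀ R : ℝ, R₀ ≤ R → ρ₁ (c 0) ≤ R →
      ∀ D' ∈ admissibleVacuumData X,
        (∀ x ∉ e.far R, D'.h.inner x = (G c).h.inner x ∧ D'.k x = (G c).k x) →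
        (∀ x ∈ e.far R, D'.h.inner x = (T R).h.inner x ∧ D'.k x = (T R).k x) → P D') :
    ∃ (e' : AFEnd X) (F : EuclideanSpace ℝ (Fin 1) → InitialDataSet (𝓡 3) X),
      IsTameDataFamily e' 1 F ∧ F 0 = d ∧ (∀ c, F c ∈ admissibleVacuumData X) ∧
        ∃ ε > (0 : ℝ), ∀ c, 0 < c 0 → c 0 < ε → P (F c) := by
  classical
  obtain ⟨hGs, hG0, hGadm, K, hK, hagree⟩ := hG
  obtain ⟨hTspec, hTsmooth, hMcont, hMlim, hwlim⟩ := hT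
  -- radii: the kick support sits inside `closedFar Rb`'s complement, far regions beyond `Rb` miss `K`
  obtain ⟨R_K, hR_K⟩ := e.exists_forall_far_disjoint hK
  set Rb : ℝ := max R_K e.R + 1 with hRb_def
  have hRbR : e.R < Rb := by
    have := le_max_right R_K e.R
    linarith
  have hRbK : R_K < Rb := by
    have := le_max_left R_K e.R
    linarith
  have hfarK : ∀ R, Rb ≤ R → ∀ x ∈ e.far R, x ∉ K := fun R hR x hx hxK ↦
    Set.disjoint_left.1 (hR_K R (hRbK.le.trans hR)) hx hxK
  set W : Set X := (e.closedFar Rb)ᶜ with hW_def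
  have hKW : K ⊆ W := by
    intro x hxK hxC
    exact Set.disjoint_left.1 (hR_K R_K le_rfl) (e.closedFar_subset_far hRbK hxC) hxK
  have hW_open : IsOpen W := (e.isClosed_closedFar hRbR).isOpen_compl
  have hfarW : ∀ R, Rb ≤ R → ∀ x ∈ W, x ∉ e.far R := fun R hR x hxW hx ↦
    hxW ((e.far_mono hR).trans (e.far_subset_closedFar Rb) hx)
  -- the smooth receding schedule
  set A : ℝ := max R₀ Rb with hA_def
  obtain ⟨ρ, hρ_smooth, hρA, hρ₁, hρ_lim⟩ := exists_schedule hδ hbd A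
  have hρR₀ : ∀ s, 0 < s → R₀ ≤ ρ s := fun s hs ↦ (le_max_left _ _).trans (hρA s hs)
  have hρRb : ∀ s, 0 < s → Rb ≤ ρ s := fun s hs ↦ (le_max_right _ _).trans (hρA s hs)
  -- the patch data and the family
  have hPD : ∀ (c : EuclideanSpace ℝ (Fin 1)) (R : ℝ), R₀ ≤ R → Rb ≤ R →
      (T R).PatchData W K (G c).h.inner (G c).k := fun c R hR₀ hR ↦
    patchData_kick_trim e hRbR hR hK hKW (hTspec R hR₀).2.2.2 (hagree c)
  set F : EuclideanSpace ℝ (Fin 1) → InitialDataSet (𝓡 3) X := fun c ↦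
    if hc : 0 < c 0 then
      (T (ρ (c 0))).patch (hPD c (ρ (c 0)) (hρR₀ _ hc) (hρRb _ hc))
    else G c with hF_def
  have hF_pos : ∀ c (hc : 0 < c 0),
      F c = (T (ρ (c 0))).patch (hPD c (ρ (c 0)) (hρR₀ _ hc) (hρRb _ hc)) := fun c hc ↦ by
    simp only [hF_def, dif_pos hc]
  have hF_nonpos : ∀ c, ¬ 0 < c 0 → F c = G c := fun c hc ↦ by
    simp only [hF_def, dif_neg hc]
  -- sections of the members with `c₀ > 0`
  have hF_core : ∀ c, 0 < c 0 → ∀ x ∉ e.far (ρ (c 0)),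
      (F c).h.inner x = (G c).h.inner x ∧ (F c).k x = (G c).k x := by
    intro c hc x hx
    rw [hF_pos c hc]
    by_cases hxW : x ∈ W
    · exact ⟨patch_h_inner_of_mem _ hxW, patch_k_of_mem _ hxW⟩
    · have hxK : x ∉ K := fun h ↦ hxW (hKW h)
      rw [patch_h_inner_of_not_mem _ hxW, patch_k_of_not_mem _ hxW,
        ((hTspec _ (hρR₀ _ hc)).2.2.2 x hx).1, ((hTspec _ (hρR₀ _ hc)).2.2.2 x hx).2,
        (hagree c x hxK).1, (hagree c x hxK).2]
      exact ⟨rfl, rfl⟩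
  have hF_far : ∀ c, 0 < c 0 → ∀ x ∈ e.far (ρ (c 0)),
      (F c).h.inner x = (T (ρ (c 0))).h.inner x ∧ (F c).k x = (T (ρ (c 0))).k x := by
    intro c hc x hx
    rw [hF_pos c hc]
    have hxW : x ∉ W := fun h ↦ hfarW _ (hρRb _ hc) x h hx
    exact ⟨patch_h_inner_of_not_mem _ hxW, patch_k_of_not_mem _ hxW⟩
  have hF_offK : ∀ c, 0 < c 0 → ∀ x ∉ K,
      (F c).h.inner x = (T (ρ (c 0))).h.inner x ∧ (F c).k x = (T (ρ (c 0))).k x := by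
    intro c hc x hxK
    rw [hF_pos c hc]
    exact ⟨patch_h_inner_of_not_mem_closed _ hxK, patch_k_of_not_mem_closed _ hxK⟩
  -- admissibility of the members
  have hF_adm : ∀ c, F c ∈ admissibleVacuumData X := by
    intro c
    by_cases hc : 0 < c 0
    · have hTadm : T (ρ (c 0)) ∈ admissibleVacuumData X := (hTspec _ (hρR₀ _ hc)).1
      refine mem_admissibleVacuumData_of_agree_off_compact hTadm ?_ hK (hF_offK c hc)
      intro inst x
      by_cases hxW : x ∈ W
      · -- near `x ∈ W` the member is the kicked datum `G c`
        haveI : (G c).metric.HasLeviCivita := (G c).metric.hasLeviCivita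
        have hv : (G c).IsVacuumConstraintSolution := (hGadm c).1.1
        have hev : ∀ᶠ y in 𝓝 x, (F c).h.inner y = (G c).h.inner y ∧ (F c).k y = (G c).k y := by
          rw [hF_pos c hc]
          exact patch_eventuallyEq_of_mem (hPD c (ρ (c 0)) (hρR₀ _ hc) (hρRb _ hc)) hxW
        refine (isVacuumAt_congr (D := G c) (D' := F c) ?_ ?_).1 (hv x)
        · exact hev.mono fun y hy ↦ hy.1.symm
        · exact hev.mono fun y hy ↦ hy.2.symm
      · -- near `x ∉ K` the member is the trimmed datum
        have hxK : x ∉ K := fun h ↦ hxW (hKW h)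
        haveI : (T (ρ (c 0))).metric.HasLeviCivita := (T (ρ (c 0))).metric.hasLeviCivita
        have hv : (T (ρ (c 0))).IsVacuumConstraintSolution := hTadm.1.1
        have hev : ∀ᶠ y in 𝓝 x, (F c).h.inner y = (T (ρ (c 0))).h.inner y ∧
            (F c).k y = (T (ρ (c 0))).k y := by
          rw [hF_pos c hc]
          exact patch_eventuallyEq_of_not_mem (hPD c (ρ (c 0)) (hρR₀ _ hc) (hρRb _ hc)) hxK
        refine (isVacuumAt_congr (D := T (ρ (c 0))) (D' := F c) ?_ ?_).1 (hv x)
        · exact hev.mono fun y hy ↦ hy.1.symm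
        · exact hev.mono fun y hy ↦ hy.2.symm
    · rw [hF_nonpos c hc]
      exact hGadm c
  -- joint smoothness (local: near core points the family is `G`, near far points `c ↦ T (ρ c₀)`)
  have hproj : ContDiff ℝ ∞ (fun c : EuclideanSpace ℝ (Fin 1) ↦ c 0) :=
    contDiff_piLp_apply (𝕜 := ℝ) (n := ∞) (p := 2) (E := fun _ : Fin 1 => ℝ) (i := 0)
  have hproj_cont : Continuous (fun c : EuclideanSpace ℝ (Fin 1) ↦ c 0) := hproj.continuous
  have hF_smooth : IsSmoothDataFamily 1 F := by
    refine isSmoothDataFamily_of_locally_eq fun p ↦ ?_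
    obtain ⟨c, x⟩ := p
    by_cases hc : 0 < c 0
    · by_cases hxK : x ∈ K
      · -- near `(c, x)` with `x ∈ K ⊆ W`: the family is `G`
        refine ⟨G, hGs, ?_⟩
        have h1 : ∀ᶠ c' in 𝓝 c, 0 < c' 0 := hproj_cont.continuousAt.eventually (eventually_gt_nhds hc)
        have h2 : ∀ᶠ y in 𝓝 x, y ∈ W := hW_open.mem_nhds (hKW hxK)
        filter_upwards [h1.prod_nhds h2] with q hq
        exact hF_core q.1 hq.1 q.2 (hfarW _ (hρRb _ hq.1) q.2 hq.2)
      · -- near `(c, x)` with `x ∉ K`: the family is `c ↦ T (ρ c₀)`, smooth along a global schedule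
        obtain ⟨ρ', hρ', hρ'A, hρ'eq⟩ :=
          exists_contDiff_extension_Ici hρ_smooth hρA (half_pos hc)
        refine ⟨fun c' ↦ T (ρ' (c' 0)), hTsmooth (fun c' ↦ ρ' (c' 0)) (hρ'.comp hproj)
          (fun c' ↦ (le_max_left _ _).trans (hρ'A _)), ?_⟩
        have h1 : ∀ᶠ c' in 𝓝 c, c 0 / 2 < c' 0 :=
          hproj_cont.continuousAt.eventually (eventually_gt_nhds (by linarith))
        have h2 : ∀ᶠ y in 𝓝 x, y ∉ K := hK.isClosed.isOpen_compl.mem_nhds hxK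
        filter_upwards [h1.prod_nhds h2] with q hq
        have hq0 : 0 < q.1 0 := by linarith [hq.1]
        rw [hρ'eq _ hq.1.le]
        exact hF_offK q.1 hq0 q.2 hq.2
    · -- near `(c, x)` with `c₀ ≤ 0`: the family is `G` (the trimming radius has receded past `x`)
      refine ⟨G, hGs, ?_⟩
      obtain ⟨V, hV, Rstar, hRstar⟩ := e.exists_nhds_forall_disjoint_far x
      have h1 : ∀ᶠ c' in 𝓝 c, 0 < c' 0 → Rstar ≤ ρ (c' 0) := by
        rcases lt_or_eq_of_le (not_lt.1 hc) with hlt | heq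
        · exact (hproj_cont.continuousAt.eventually (eventually_lt_nhds hlt)).mono
            fun c' hc' hc'' ↦ absurd hc'' (not_lt.2 hc'.le)
        · have hev : ∀ᶠ s in 𝓝[>] (0 : ℝ), Rstar ≤ ρ s := hρ_lim.eventually (eventually_ge_atTop _)
          rw [eventually_nhdsWithin_iff] at hev
          have hc0 : ContinuousAt (fun c' : EuclideanSpace ℝ (Fin 1) ↦ c' 0) c :=
            hproj_cont.continuousAt
          rw [ContinuousAt, heq] at hc0
          exact (hc0.eventually hev).mono fun c' hc' hpos ↦ hc' hpos
      filter_upwards [h1.prod_nhds (Filter.Eventually.of_forall (p := fun y ↦ y ∈ V → y ∈ V)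
        fun _ h ↦ h), prod_mem_nhds univ_mem hV] with q hq hqV
      by_cases hq0 : 0 < q.1 0
      · exact hF_core q.1 hq0 q.2 fun hfar ↦
          Set.disjoint_left.1 (hRstar _ (hq.1 hq0)) hfar hqV.2
      · rw [hF_nonpos q.1 hq0]
        exact ⟨rfl, rfl⟩
  -- tameness on the collar `e.restrict (e.R + 1)`
  have hR₁ : e.R < e.R + 1 := by linarith
  have hGt : IsTameDataFamily (e.restrict hR₁.le) 1 G := by
    have hagree0 : ∀ c, ∀ x ∉ K, (G c).h.inner x = (G 0).h.inner x ∧ (G c).k x = (G 0).k x := by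
      intro c x hx
      rw [hG0]
      exact hagree c x hx
    have hDR0 : e.IsStronglyAsymptoticallyFlatDR (G 0) M₀ := by rw [hG0]; exact hDR
    exact isTameDataFamily_restrict_of_agree_off_compact_one hGs hsole hDR0 hK hagree0 hR₁
  have hF_tame : IsTameDataFamily (e.restrict hR₁.le) 1 F := by
    -- the mass function of the members
    set m : ℝ → ℝ := fun s ↦ if 0 < s then M (ρ s) else M₀ with hm_def
    have hm_cont : Continuous m := by
      refine continuous_iff_continuousAt.2 fun s ↦ ?_
      rcases lt_trichotomy s 0 with hs | hs | hs
      · have hev : (fun _ : ℝ ↦ M₀) =ᶠ[𝓝 s] m := (eventually_lt_nhds hs).mono fun t ht ↦ by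
          simp only [hm_def, if_neg (not_lt.2 ht.le)]
        exact continuousAt_const.congr hev
      · subst hs
        have hm0 : m 0 = M₀ := by simp only [hm_def, lt_irrefl, if_false]
        rw [continuousAt_iff_continuous_left'_right']
        constructor
        · have hev : (fun _ : ℝ ↦ M₀) =ᶠ[𝓝[<] (0 : ℝ)] m := by
            filter_upwards [self_mem_nhdsWithin] with t ht
            simp only [hm_def, if_neg (not_lt.2 (le_of_lt (Set.mem_Iio.1 ht)))]
          show Tendsto m (𝓝[<] 0) (𝓝 (m 0))
          rw [hm0]
          exact tendsto_const_nhds.congr' hev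
        · have hev : (fun t : ℝ ↦ M (ρ t)) =ᶠ[𝓝[>] (0 : ℝ)] m := by
            filter_upwards [self_mem_nhdsWithin] with t ht
            simp only [hm_def, if_pos (show 0 < t from ht)]
          show Tendsto m (𝓝[>] 0) (𝓝 (m 0))
          rw [hm0]
          exact (hMlim.comp hρ_lim).congr' hev
      · have hev : (fun t : ℝ ↦ M (ρ t)) =ᶠ[𝓝 s] m := (eventually_gt_nhds hs).mono fun t ht ↦ by
          simp only [hm_def, if_pos ht]
        have hρc : ContinuousAt ρ s := hρ_smooth.continuousOn.continuousAt (Ioi_mem_nhds hs)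
        have hMc : ContinuousWithinAt M (Ici R₀) (ρ s) := hMcont _ (hρR₀ s hs)
        have h1 : ContinuousWithinAt (fun t : ℝ ↦ M (ρ t)) (Ioi 0) s :=
          hMc.comp hρc.continuousWithinAt fun t ht ↦ hρR₀ t ht
        exact (h1.continuousAt (Ioi_mem_nhds hs)).congr hev
    -- decay of the members on the collared end, with mass `m c₀`
    have hF_DR : ∀ c, (e.restrict hR₁.le).IsStronglyAsymptoticallyFlatDR (F c) (m (c 0)) := by
      intro c
      rw [e.isStronglyAsymptoticallyFlatDR_restrict_iff hR₁.le]
      by_cases hc : 0 < c 0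
      · simp only [hm_def, if_pos hc]
        exact AFEnd.IsStronglyAsymptoticallyFlatDR.congr_of_eqOn_far (R₀ := ρ (c 0))
          (fun q hq ↦ (hF_far c hc q hq).1) (fun q hq ↦ (hF_far c hc q hq).2)
          (hTspec _ (hρR₀ _ hc)).2.2.1
      · simp only [hm_def, if_neg hc]
        rw [hF_nonpos c hc]
        exact AFEnd.IsStronglyAsymptoticallyFlatDR.congr_of_eqOn_far (R₀ := Rb)
          (fun q hq ↦ (hagree c q (hfarK Rb le_rfl q hq)).1)
          (fun q hq ↦ (hagree c q (hfarK Rb le_rfl q hq)).2) hDR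
    -- the far surgery has vanishing weighted size: `wDist (F c) (G c) = wDist (T (ρ c₀)) d → 0`
    set u : ℝ → ℝ≥0∞ := fun s ↦ if 0 < s then e.wDist (T (ρ s)) d else 0 with hu_def
    have hle : ∀ c, (e.restrict hR₁.le).wDist (F c) (G c) ≤ u (c 0) := by
      intro c
      by_cases hc : 0 < c 0
      · simp only [hu_def, if_pos hc]
        have heq : (e.restrict hR₁.le).wDist (F c) (G c) =
            (e.restrict hR₁.le).wDist (T (ρ (c 0))) d := by
          refine wDist_eq_of_forall _ fun x ↦ ?_
          by_cases hx : x ∈ e.far (ρ (c 0))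
          · exact Or.inr ⟨hF_far c hc x hx, hagree c x (hfarK _ (hρRb _ hc) x hx)⟩
          · exact Or.inl ⟨hF_core c hc x hx, (hTspec _ (hρR₀ _ hc)).2.2.2 x hx⟩
        rw [heq]
        exact wDist_restrict_le e hR₁.le _ _
      · simp only [hu_def, if_neg hc]
        rw [hF_nonpos c hc, AFEnd.wDist_self]
    have hu : Tendsto u (𝓝 0) (𝓝 0) := by
      have hleft : Tendsto u (𝓝[≤] 0) (𝓝 0) := by
        refine tendsto_const_nhds.congr' ?_
        filter_upwards [self_mem_nhdsWithin] with t ht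
        simp only [hu_def, if_neg (not_lt.2 (Set.mem_Iic.1 ht))]
      have hright : Tendsto u (𝓝[>] 0) (𝓝 0) := by
        refine (hwlim.comp hρ_lim).congr' ?_
        filter_upwards [self_mem_nhdsWithin] with t ht
        simp only [hu_def, if_pos (show 0 < t from ht), Function.comp_apply]
      have h := hleft.sup hright
      rwa [nhdsLE_sup_nhdsGT] at h
    have hu' : Tendsto (fun c : EuclideanSpace ℝ (Fin 1) ↦ u (c 0)) (𝓝 0) (𝓝 0) := by
      have h0 : ContinuousAt (fun c : EuclideanSpace ℝ (Fin 1) ↦ c 0) 0 := hproj_cont.continuousAt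
      rw [ContinuousAt] at h0
      simp only [PiLp.zero_apply] at h0
      exact hu.comp h0
    have hw : Tendsto (fun c ↦ (e.restrict hR₁.le).wDist (F c) (G c)) (𝓝 0) (𝓝 0) :=
      tendsto_of_tendsto_of_tendsto_of_le_of_le tendsto_const_nhds hu' (fun c ↦ bot_le) hle
    have h0 : F 0 = G 0 := hF_nonpos 0 (by simp)
    exact hGt.of_wDist_tendsto hF_smooth h0 (hm_cont.comp hproj_cont) hF_DR hw
  -- conclusion
  refine ⟨e.restrict hR₁.le, F, hF_tame, ?_, hF_adm, δ / 2, by positivity, fun c hc hcδ ↦ ?_⟩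
  · have h0 : ¬ (0 : ℝ) < (0 : EuclideanSpace ℝ (Fin 1)) 0 := by simp
    rw [hF_nonpos 0 h0, hG0]
  · exact hgood c hc (by linarith) (ρ (c 0)) (hρR₀ _ hc) (hρ₁ _ hc hcδ) (F c) (hF_adm c)
      (hF_core c hc) (hF_far c hc)

end Core

/-! ### The assembly: the three pieces give one-sided tame escape, hence the crux -/

/-- A threshold bounded on every compact subinterval of `(0, δ)` is locally bounded there
(filter form). [folklore] -/
theorem locallyBdd_of_bddAbove_Icc {ρ₁ : ℝ → ℝ} {δ : ℝ}
    (h : ∀ a b : ℝ, 0 < a → a ≤ b → b < δ → BddAbove (ρ₁ '' Set.Icc a b)) :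
    ∀ s : ℝ, 0 < s → s < δ → ∃ C : ℝ, ∀ᶠ s' in 𝓝 s, ρ₁ s' ≤ C := by
  intro s hs hsδ
  obtain ⟨C, hC⟩ := h (s / 2) ((s + δ) / 2) (by positivity) (by linarith) (by linarith)
  refine ⟨C, ?_⟩
  have hmem : Set.Icc (s / 2) ((s + δ) / 2) ∈ 𝓝 s := Icc_mem_nhds (by linarith) (by linarith)
  filter_upwards [hmem] with s' hs'
  exact hC ⟨s', hs', rfl⟩

/-- **ONE-SIDED TAME ESCAPE WITH ONE MAXIMAL DEVELOPMENT FROM THE THREE PIECES** (the hypothesis of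
the landed `modulatedKerrHandoff_of_tameEscapeExists`). Through an admissible datum `d` failing the
handoff property: its sole end carries a tame trimming family (piece `TameEndTrimming`); a censored
local kick family through `d` is the constant one if every MGHD of `d` has complete `𝓘⁺`, else the
one of piece `KickCensorship`; piece `CensoredKickHandoff` hands back a local kick family `G` and a
locally bounded trimming threshold beyond which every "`G c` inside, `T R` outside" datum has a
maximal development with the handoff clause; `exists_tameCurve_of_kick_trim` builds from them the
tame curve. [cite: Christodoulou1999, p. A24] -/
theorem tameEscapeExists_of_trim_kick
    (hT : ∀ (X : Type) [TopologicalSpace X] [ChartedSpace E3 X] [IsManifold (𝓡 3) ((⊤ : ℕ∞) : WithTop ℕ∞) X] [T2Space X] [SecondCountableTopology X] [ConnectedSpace X], ∀ d ∈ admissibleVacuumData X, ∀ (e : AFEnd X) (M₀ : ℝ), e.IsSoleEnd → e.IsStronglyAsymptoticallyFlatDR d M₀ → ∃ (R₀ : ℝ) (T : ℝ → InitialDataSet (𝓡 3) X) (M : ℝ → ℝ), IsTameTrimmingFamily X e d M₀ R₀ T M)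
    (hW : ∀ (X : Type) [TopologicalSpace X] [ChartedSpace E3 X] [IsManifold (𝓡 3) ((⊤ : ℕ∞) : WithTop ℕ∞) X] [T2Space X] [SecondCountableTopology X] [ConnectedSpace X], ∀ d ∈ admissibleVacuumData X, (¬ ∀ 𝒟 : VacuumCauchyDevelopment d, 𝒟.IsMaximal → Summit.FinalStateConjecture.HasCompleteNullInfinity 𝒟.toCauchyDevelopment) → ∃ G : EuclideanSpace ℝ (Fin 1) → InitialDataSet (𝓡 3) X, IsLocalKick X d G ∧ ∃ δ : ℝ, 0 < δ ∧ ∀ c : EuclideanSpace ℝ (Fin 1), 0 < c 0 → c 0 < δ → ∀ 𝒟 : VacuumCauchyDevelopment (G c), 𝒟.IsMaximal → Summit.FinalStateConjecture.HasCompleteNullInfinity 𝒟.toCauchyDevelopment)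
    (hK : ∀ (X : Type) [TopologicalSpace X] [ChartedSpace E3 X] [IsManifold (𝓡 3) ((⊤ : ℕ∞) : WithTop ℕ∞) X] [T2Space X] [SecondCountableTopology X] [ConnectedSpace X], ∀ d ∈ admissibleVacuumData X, ¬ HandoffPropT X d → ∀ (G₁ : EuclideanSpace ℝ (Fin 1) → InitialDataSet (𝓡 3) X) (δ₁ : ℝ), IsLocalKick X d G₁ → 0 < δ₁ → (∀ c : EuclideanSpace ℝ (Fin 1), 0 < c 0 → c 0 < δ₁ → ∀ 𝒟 : VacuumCauchyDevelopment (G₁ c), 𝒟.IsMaximal → Summit.FinalStateConjecture.HasCompleteNullInfinity 𝒟.toCauchyDevelopment) → ∀ (e : AFEnd X) (M₀ R₀ : ℝ) (T : ℝ → InitialDataSet (𝓡 3) X) (M : ℝ → ℝ), e.IsSoleEnd → e.IsStronglyAsymptoticallyFlatDR d M₀ → IsTameTrimmingFamily X e d M₀ R₀ T M → ∃ G : EuclideanSpace ℝ (Fin 1) → InitialDataSet (𝓡 3) X, IsLocalKick X d G ∧ ∃ (δ : ℝ) (ρ₁ : ℝ → ℝ), 0 < δ ∧ (∀ a b : ℝ,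 0 < a → a ≤ b → b < δ → BddAbove (ρ₁ '' Set.Icc a b)) ∧ ∀ c : EuclideanSpace ℝ (Fin 1), 0 < c 0 → c 0 < δ → ∀ R : ℝ, R₀ ≤ R → ρ₁ (c 0) ≤ R → ∀ D' ∈ admissibleVacuumData X, (∀ x ∉ e.far R, D'.h.inner x = (G c).h.inner x ∧ D'.k x = (G c).k x) → (∀ x ∈ e.far R, D'.h.inner x = (T R).h.inner x ∧ D'.k x = (T R).k x) → ∃ 𝒟 : VacuumCauchyDevelopment D', 𝒟.IsMaximal ∧ HandoffClause X D' 𝒟) :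
    ∀ (X : Type) [TopologicalSpace X] [ChartedSpace E3 X] [IsManifold (𝓡 3) ((⊤ : ℕ∞) : WithTop ℕ∞) X] [T2Space X] [SecondCountableTopology X] [ConnectedSpace X], ∀ d ∈ admissibleVacuumData X, ¬ HandoffPropT X d → ∃ (e : AFEnd X) (F : EuclideanSpace ℝ (Fin 1) → InitialDataSet (𝓡 3) X), IsTameDataFamily e 1 F ∧ F 0 = d ∧ (∀ c, F c ∈ admissibleVacuumData X) ∧ ∃ ε > (0 : ℝ), ∀ c, 0 < c 0 → c 0 < ε → ∃ 𝒟 : VacuumCauchyDevelopment (F c), 𝒟.IsMaximal ∧ HandoffClause X (F c) 𝒟 := by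
  intro X _ _ _ _ _ _ d hd hP
  obtain ⟨e, M₀, hsole, hDR⟩ := hd.2
  -- the trim leg
  obtain ⟨R₀, T, M, hTrim⟩ := hT X d hd e M₀ hsole hDR
  -- a censored local kick family through `d`
  have hcens : ∃ (G₁ : EuclideanSpace ℝ (Fin 1) → InitialDataSet (𝓡 3) X) (δ₁ : ℝ),
      IsLocalKick X d G₁ ∧ 0 < δ₁ ∧ ∀ c : EuclideanSpace ℝ (Fin 1), 0 < c 0 → c 0 < δ₁ →
        ∀ 𝒟 : VacuumCauchyDevelopment (G₁ c), 𝒟.IsMaximal →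
          Summit.FinalStateConjecture.HasCompleteNullInfinity 𝒟.toCauchyDevelopment := by
    by_cases hC : ∀ 𝒟 : VacuumCauchyDevelopment d, 𝒟.IsMaximal →
        Summit.FinalStateConjecture.HasCompleteNullInfinity 𝒟.toCauchyDevelopment
    · exact ⟨fun _ ↦ d, 1, ⟨isSmoothDataFamily_const 1 d, rfl, fun _ ↦ hd, ∅, isCompact_empty,
        fun _ _ _ ↦ ⟨rfl, rfl⟩⟩, one_pos, fun _ _ _ ↦ hC⟩
    · obtain ⟨G₁, hG₁, δ₁, hδ₁, h⟩ := hW X d hd hC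
      exact ⟨G₁, δ₁, hG₁, hδ₁, h⟩
  obtain ⟨G₁, δ₁, hG₁, hδ₁, hG₁cens⟩ := hcens
  -- the kick leg handed back by `CensoredKickHandoff`, and the construction
  obtain ⟨G, hG, δ, ρ₁, hδ, hbd, hgood⟩ :=
    hK X d hd hP G₁ δ₁ hG₁ hδ₁ hG₁cens e M₀ R₀ T M hsole hDR hTrim
  exact exists_tameCurve_of_kick_trim d e M₀ R₀ T M hsole hDR hTrim G hG hδ
    (locallyBdd_of_bddAbove_Icc hbd)
    (fun D' ↦ ∃ 𝒟 : VacuumCauchyDevelopment D', 𝒟.IsMaximal ∧ HandoffClause X D' 𝒟) hgood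

-- operator-norm instance paths on form-valued maps are slow to unify (clause (QS))
set_option synthInstance.maxHeartbeats 400000 in
/-- **`ModulatedKerrHandoff` FROM THE THREE PIECES `TameEndTrimming`, `KickCensorship`,
`CensoredKickHandoff`** — the crux-strategist's decomposition of item stmt-FinalStateConjecture-17402
(conclusion = the crux body VERBATIM, Theses-free): `tameEscapeExists_of_trim_kick` composed with the
landed `modulatedKerrHandoff_of_tameEscapeExists`. [cite: Christodoulou1999, p. A24] -/
theorem modulatedKerrHandoff_of_trim_kick
    (hT : ∀ (X : Type) [TopologicalSpace X] [ChartedSpace E3 X] [IsManifold (𝓡 3) ((⊤ : ℕ∞) : WithTop ℕ∞) X] [T2Space X] [SecondCountableTopology X] [ConnectedSpace X], ∀ d ∈ admissibleVacuumData X, ∀ (e : AFEnd X) (M₀ : ℝ), e.IsSoleEnd → e.IsStronglyAsymptoticallyFlatDR d M₀ → ∃ (R₀ : ℝ) (T : ℝ → InitialDataSet (𝓡 3) X) (M : ℝ → ℝ), IsTameTrimmingFamily X e d M₀ R₀ T M)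
    (hW : ∀ (X : Type) [TopologicalSpace X] [ChartedSpace E3 X] [IsManifold (𝓡 3) ((⊤ : ℕ∞) : WithTop ℕ∞) X] [T2Space X] [SecondCountableTopology X] [ConnectedSpace X], ∀ d ∈ admissibleVacuumData X, (¬ ∀ 𝒟 : VacuumCauchyDevelopment d, 𝒟.IsMaximal → Summit.FinalStateConjecture.HasCompleteNullInfinity 𝒟.toCauchyDevelopment) → ∃ G : EuclideanSpace ℝ (Fin 1) → InitialDataSet (𝓡 3) X, IsLocalKick X d G ∧ ∃ δ : ℝ, 0 < δ ∧ ∀ c : EuclideanSpace ℝ (Fin 1), 0 < c 0 → c 0 < δ → ∀ 𝒟 : VacuumCauchyDevelopment (G c), 𝒟.IsMaximal → Summit.FinalStateConjecture.HasCompleteNullInfinity 𝒟.toCauchyDevelopment)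
    (hK : ∀ (X : Type) [TopologicalSpace X] [ChartedSpace E3 X] [IsManifold (𝓡 3) ((⊤ : ℕ∞) : WithTop ℕ∞) X] [T2Space X] [SecondCountableTopology X] [ConnectedSpace X], ∀ d ∈ admissibleVacuumData X, ¬ HandoffPropT X d → ∀ (G₁ : EuclideanSpace ℝ (Fin 1) → InitialDataSet (𝓡 3) X) (δ₁ : ℝ), IsLocalKick X d G₁ → 0 < δ₁ → (∀ c : EuclideanSpace ℝ (Fin 1), 0 < c 0 → c 0 < δ₁ → ∀ 𝒟 : VacuumCauchyDevelopment (G₁ c), 𝒟.IsMaximal → Summit.FinalStateConjecture.HasCompleteNullInfinity 𝒟.toCauchyDevelopment) → ∀ (e : AFEnd X) (M₀ R₀ : ℝ) (T : ℝ → InitialDataSet (𝓡 3) X) (M : ℝ → ℝ), e.IsSoleEnd → e.IsStronglyAsymptoticallyFlatDR d M₀ → IsTameTrimmingFamily X e d M₀ R₀ T M → ∃ G : EuclideanSpace ℝ (Fin 1) → InitialDataSet (𝓡 3) X, IsLocalKick X d G ∧ ∃ (δ : ℝ) (ρ₁ : ℝ → ℝ), 0 < δ ∧ (∀ a b : ℝ,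 0 < a → a ≤ b → b < δ → BddAbove (ρ₁ '' Set.Icc a b)) ∧ ∀ c : EuclideanSpace ℝ (Fin 1), 0 < c 0 → c 0 < δ → ∀ R : ℝ, R₀ ≤ R → ρ₁ (c 0) ≤ R → ∀ D' ∈ admissibleVacuumData X, (∀ x ∉ e.far R, D'.h.inner x = (G c).h.inner x ∧ D'.k x = (G c).k x) → (∀ x ∈ e.far R, D'.h.inner x = (T R).h.inner x ∧ D'.k x = (T R).k x) → ∃ 𝒟 : VacuumCauchyDevelopment D', 𝒟.IsMaximal ∧ HandoffClause X D' 𝒟) :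
    ∀ (X : Type) [TopologicalSpace X] [ChartedSpace E3 X] [IsManifold (𝓡 3) ((⊤ : ℕ∞) : WithTop ℕ∞) X] [T2Space X] [SecondCountableTopology X] [ConnectedSpace X], InitialDataSet.IsTameChristodoulouGeneric (admissibleVacuumData X) (fun D ↦ (∃ 𝒟 : VacuumCauchyDevelopment D, 𝒟.IsMaximal) ∧ ∀ 𝒟 : VacuumCauchyDevelopment D, 𝒟.IsMaximal → Summit.FinalStateConjecture.HasCompleteNullInfinity 𝒟.toCauchyDevelopment ∧ (∃ (N : ℕ) (M a rin : Fin N → ℝ) (Λ : Fin N → ℝ → lorentzGroup) (ξ : Fin N → ℝ → E3) (γ κ τ₀ : ℝ) (U : Opens E4) (Φ : U → 𝒟.carrier) (O : Set 𝒟.carrier), (∀ i, Kerr.IsSubextremal (M i) (a i) ∧ Kerr.rMinus (M i) (a i) < rin i ∧ rin i < Kerr.rPlus (M i) (a i)) ∧ (∀ i t, |((Λ i t : E4 ≃L[ℝ] E4) (E4.basisVector 0)) 0| ≤ γ) ∧ (∀ i, ContDiff ℝ ((⊤ : ℕ∞) : WithTop ℕ∞) (ξ i) ∧ ContDiff ℝ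 ((⊤ : ℕ∞) : WithTop ℕ∞) (fun t ↦ ((Λ i t : E4 ≃L[ℝ] E4) : E4 →L[ℝ] E4))) ∧ (∀ i j, i ≠ j → Tendsto (fun t ↦ ‖ξ i t - ξ j t‖) atTop atTop) ∧ (0 < κ ∧ κ < 1 ∧ ∀ i, ∀ᶠ t in atTop, ‖ξ i t‖ ≤ κ ^ 2 * t) ∧ ({x : E4 | τ₀ < x 0 ∧ ∀ i, rin i < Kerr.radius (a i) (poincareInv (Λ i (x 0)) (E4.ofTimeSpace (x 0) (ξ i (x 0))) x)} ⊆ (U : Set E4)) ∧ let B : ModelBackground := ⟨U, fun x ↦ Minkowski.bilin + ∑ i, (boostedKerrBilin (Λ i (x 0)) (E4.ofTimeSpace (x 0) (ξ i (x 0))) (M i) (a i) x - Minkowski.bilin), fun x ↦ x 0, E4.spatialNorm⟩; ContMDiff 𝓘(ℝ, E4) (𝓡 4) ((⊤ : ℕ∞) : WithTop ℕ∞) Φ ∧ Topology.IsOpenEmbedding ((B.lateRegion τ₀).restrict Φ) ∧ Φ '' {x : U | τ₀ < x.1 0 ∧ ∀ i, Kerr.rPlus (M i) (a i) < Kerr.radius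 (a i) (poincareInv (Λ i (x.1 0)) (E4.ofTimeSpace (x.1 0) (ξ i (x.1 0))) x.1)} ⊆ O ∧ Tendsto (fun t ↦ 𝒟.toSpacetime.deviationCk B Φ 3 t) atTop (𝓝 0) ∧ Tendsto (fun t : ℝ ↦ ⨆ x ∈ {x : U | x.1 0 = t ∧ E4.spatialNorm x.1 ≤ κ * t}, ⨆ (m : ℕ) (_ : m ≤ 3), ENNReal.ofReal (1 + √(√((⨅ i, ‖E4.spatial x.1 - ξ i t‖) ^ 7))) * ‖iteratedFDeriv ℝ m (𝒟.toSpacetime.deviationExtend B Φ) x.1‖ₑ) atTop (𝓝 0) ∧ O = Summit.FinalStateConjecture.exteriorOf 𝒟.toCauchyDevelopment (Φ '' {x : U | τ₀ < x.1 0 ∧ ∀ i, Kerr.rPlus (M i) (a i) < Kerr.radius (a i) (poincareInv (Λ i (x.1 0)) (E4.ofTimeSpace (x.1 0) (ξ i (x.1 0))) x.1)}) ∧ (∀ t₁ : ℝ, τ₀ < t₁ → O \ Φ '' {x : U | t₁ < x.1 0 ∧ ∀ i, Kerr.rPlus (M i) (a i) < Kerr.radius (a i) (poincareInv (Λ i (x.1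 0)) (E4.ofTimeSpace (x.1 0) (ξ i (x.1 0))) x.1)} ⊆ 𝒟.metric.causalPast 𝒟.timeOrientation (Φ '' {x : U | x.1 0 = t₁ ∧ ∀ i, Kerr.rPlus (M i) (a i) < Kerr.radius (a i) (poincareInv (Λ i (x.1 0)) (E4.ofTimeSpace (x.1 0) (ξ i (x.1 0))) x.1)})) ∧ (∃ τ₁ : ℝ, ∀ x y : U, (τ₁ < x.1 0 ∧ ∀ i, rin i < Kerr.radius (a i) (poincareInv (Λ i (x.1 0)) (E4.ofTimeSpace (x.1 0) (ξ i (x.1 0))) x.1)) → (τ₁ < y.1 0 ∧ ∀ i, rin i < Kerr.radius (a i) (poincareInv (Λ i (y.1 0)) (E4.ofTimeSpace (y.1 0) (ξ i (y.1 0))) y.1)) → Φ y ∈ 𝒟.metric.causalFuture 𝒟.timeOrientation {Φ x} → x.1 0 ≤ y.1 0) ∧ (∀ (i : Fin N) (t : ℝ), 0 < (((Λ i t : lorentzGroup) : E4 ≃L[ℝ] E4) (E4.basisVector 0)) 0) ∧ Summit.FinalStateConjecture.RaysStayInClosure 𝒟.toCauchyDevelopment O ∧ (∀ ρ : ℝ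 → ℝ, Tendsto ρ atTop atTop → Tendsto (fun t : ℝ ↦ ⨆ x ∈ {x : E4 | x 0 = t ∧ E4.spatialNorm x ≤ κ * t ∧ ρ t ≤ ⨅ i, ‖E4.spatial x - ξ i t‖}, ENNReal.ofReal (1 + √(√((⨅ i, ‖E4.spatial x - ξ i t‖) ^ 7))) * ‖fderiv ℝ (fun y : E4 ↦ Minkowski.bilin + ∑ i, (boostedKerrBilin (Λ i (y 0)) (E4.ofTimeSpace (y 0) (ξ i (y 0))) (M i) (a i) y - Minkowski.bilin)) x (E4.basisVector 0)‖ₑ) atTop (𝓝 0)))) 1 :=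
  modulatedKerrHandoff_of_tameEscapeExists (tameEscapeExists_of_trim_kick hT hW hK)


-- operator-norm instance paths on form-valued maps are slow to unify (clause (QS))
set_option synthInstance.maxHeartbeats 400000 in
/-- The same assembly over the INLINED route-children statements (the texts filed by
`route edit --split`; definitional unfolding of `IsLocalKick` / `IsTrimmed` / `IsTameTrimmingFamily`). -/
theorem modulatedKerrHandoff_of_trim_kick_inlined
    (hT : open Literature.Geometry.Lorentzian in ∀ (X : Type) [TopologicalSpace X] [ChartedSpace E3 X] [IsManifold (𝓡 3) ((⊤ : ℕ∞) : WithTop ℕ∞) X] [T2Space X] [SecondCountableTopology X] [ConnectedSpace X], ∀ d ∈ admissibleVacuumData X, ∀ (e : AFEnd X) (M₀ : ℝ), e.IsSoleEnd → e.IsStronglyAsymptoticallyFlatDR d M₀ → ∃ (R₀ : ℝ) (T : ℝ → InitialDataSet (𝓡 3) X) (M : ℝ → ℝ), ((∀ R, R₀ ≤ R → T R ∈ admissibleVacuumData X ∧ (∃ Mt : ℝ, e.IsStronglyAsymptoticallyFlatWith (T R) Mt (15 / 8) (23 / 8) 4 3) ∧ e.IsStronglyAsymptoticallyFlatDR (T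 R) (M R) ∧ ∀ x ∉ e.far R, (T R).h.inner x = d.h.inner x ∧ (T R).k x = d.k x) ∧ (∀ ρ : EuclideanSpace ℝ (Fin 1) → ℝ, ContDiff ℝ ((⊤ : ℕ∞) : WithTop ℕ∞) ρ → (∀ c, R₀ ≤ ρ c) → InitialDataSet.IsSmoothDataFamily 1 (fun c ↦ T (ρ c))) ∧ ContinuousOn M (Set.Ici R₀) ∧ Tendsto M atTop (𝓝 M₀) ∧ Tendsto (fun R ↦ e.wDist (T R) d) atTop (𝓝 0)))
    (hW : open Literature.Geometry.Lorentzian in ∀ (X : Type) [TopologicalSpace X] [ChartedSpace E3 X] [IsManifold (𝓡 3) ((⊤ : ℕ∞) : WithTop ℕ∞) X] [T2Space X] [SecondCountableTopology X] [ConnectedSpace X], ∀ d ∈ admissibleVacuumData X, (¬ ∀ 𝒟 : VacuumCauchyDevelopment d, 𝒟.IsMaximal → Summit.FinalStateConjecture.HasCompleteNullInfinity 𝒟.toCauchyDevelopment) → ∃ G : EuclideanSpace ℝ (Fin 1) → InitialDataSet (𝓡 3) X, (InitialDataSet.IsSmoothDataFamily 1 G ∧ G 0 = d ∧ (∀ c,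 G c ∈ admissibleVacuumData X) ∧ ∃ K : Set X, IsCompact K ∧ ∀ c, ∀ x ∉ K, (G c).h.inner x = d.h.inner x ∧ (G c).k x = d.k x) ∧ ∃ δ : ℝ, 0 < δ ∧ ∀ c : EuclideanSpace ℝ (Fin 1), 0 < c 0 → c 0 < δ → ∀ 𝒟 : VacuumCauchyDevelopment (G c), 𝒟.IsMaximal → Summit.FinalStateConjecture.HasCompleteNullInfinity 𝒟.toCauchyDevelopment)
    (hK : open Literature.Geometry.Lorentzian in ∀ (X : Type) [TopologicalSpace X] [ChartedSpace E3 X] [IsManifold (𝓡 3) ((⊤ : ℕ∞) : WithTop ℕ∞) X] [T2Space X] [SecondCountableTopology X] [ConnectedSpace X], ∀ d ∈ admissibleVacuumData X, ¬ Summit.FinalStateConjecture.FinalStateConjecture.Theorems.EIHFluxBalance.TameTemplate.HandoffPropT X d → ∀ (G₁ : EuclideanSpace ℝ (Fin 1) → InitialDataSet (𝓡 3) X) (δ₁ : ℝ), (InitialDataSet.IsSmoothDataFamily 1 G₁ ∧ G₁ 0 = d ∧ (∀ c, G₁ c ∈ admissibleVacuumData X) ∧ ∃ K : Set X, IsCompact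 K ∧ ∀ c, ∀ x ∉ K, (G₁ c).h.inner x = d.h.inner x ∧ (G₁ c).k x = d.k x) → 0 < δ₁ → (∀ c : EuclideanSpace ℝ (Fin 1), 0 < c 0 → c 0 < δ₁ → ∀ 𝒟 : VacuumCauchyDevelopment (G₁ c), 𝒟.IsMaximal → Summit.FinalStateConjecture.HasCompleteNullInfinity 𝒟.toCauchyDevelopment) → ∀ (e : AFEnd X) (M₀ R₀ : ℝ) (T : ℝ → InitialDataSet (𝓡 3) X) (M : ℝ → ℝ), e.IsSoleEnd → e.IsStronglyAsymptoticallyFlatDR d M₀ → ((∀ R, R₀ ≤ R → T R ∈ admissibleVacuumData X ∧ (∃ Mt : ℝ, e.IsStronglyAsymptoticallyFlatWith (T R) Mt (15 / 8) (23 / 8) 4 3) ∧ e.IsStronglyAsymptoticallyFlatDR (T R) (M R) ∧ ∀ x ∉ e.far R, (T R).h.inner x = d.h.inner x ∧ (T R).k x = d.k x) ∧ (∀ ρ : EuclideanSpace ℝ (Fin 1) → ℝ, ContDiff ℝ ((⊤ : ℕ∞) : WithTop ℕ∞) ρ → (∀ c, R₀ ≤ ρ c) → InitialDataSet.IsSmoothDataFamily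 1 (fun c ↦ T (ρ c))) ∧ ContinuousOn M (Set.Ici R₀) ∧ Tendsto M atTop (𝓝 M₀) ∧ Tendsto (fun R ↦ e.wDist (T R) d) atTop (𝓝 0)) → ∃ G : EuclideanSpace ℝ (Fin 1) → InitialDataSet (𝓡 3) X, (InitialDataSet.IsSmoothDataFamily 1 G ∧ G 0 = d ∧ (∀ c, G c ∈ admissibleVacuumData X) ∧ ∃ K : Set X, IsCompact K ∧ ∀ c, ∀ x ∉ K, (G c).h.inner x = d.h.inner x ∧ (G c).k x = d.k x) ∧ ∃ (δ : ℝ) (ρ₁ : ℝ → ℝ), 0 < δ ∧ (∀ a b : ℝ, 0 < a → a ≤ b → b < δ → BddAbove (ρ₁ '' Set.Icc a b)) ∧ ∀ c : EuclideanSpace ℝ (Fin 1), 0 < c 0 → c 0 < δ → ∀ R : ℝ, R₀ ≤ R → ρ₁ (c 0) ≤ R → ∀ D' ∈ admissibleVacuumData X, (∀ x ∉ e.far R, D'.h.inner x = (G c).h.inner x ∧ D'.k x = (G c).k x) → (∀ x ∈ e.far R, D'.h.inner x = (T R).h.inner x ∧ D'.k x = (T R).k x) → ∃ 𝒟 : VacuumCauchyDevelopment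 D', 𝒟.IsMaximal ∧ Summit.FinalStateConjecture.FinalStateConjecture.Theorems.EIHFluxBalance.TameTemplate.HandoffClause X D' 𝒟) :
    ∀ (X : Type) [TopologicalSpace X] [ChartedSpace E3 X] [IsManifold (𝓡 3) ((⊤ : ℕ∞) : WithTop ℕ∞) X] [T2Space X] [SecondCountableTopology X] [ConnectedSpace X], InitialDataSet.IsTameChristodoulouGeneric (admissibleVacuumData X) (fun D ↦ (∃ 𝒟 : VacuumCauchyDevelopment D, 𝒟.IsMaximal) ∧ ∀ 𝒟 : VacuumCauchyDevelopment D, 𝒟.IsMaximal → Summit.FinalStateConjecture.HasCompleteNullInfinity 𝒟.toCauchyDevelopment ∧ (∃ (N : ℕ) (M a rin : Fin N → ℝ) (Λ : Fin N → ℝ → lorentzGroup) (ξ : Fin N → ℝ → E3) (γ κ τ₀ : ℝ) (U : Opens E4) (Φ : U → 𝒟.carrier) (O : Set 𝒟.carrier), (∀ i, Kerr.IsSubextremal (M i) (a i) ∧ Kerr.rMinus (M i) (a i) < rin i ∧ rin i < Kerr.rPlus (M i) (a i)) ∧ (∀ i t, |((Λ i t : E4 ≃L[ℝ] E4) (E4.basisVector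 0)) 0| ≤ γ) ∧ (∀ i, ContDiff ℝ ((⊤ : ℕ∞) : WithTop ℕ∞) (ξ i) ∧ ContDiff ℝ ((⊤ : ℕ∞) : WithTop ℕ∞) (fun t ↦ ((Λ i t : E4 ≃L[ℝ] E4) : E4 →L[ℝ] E4))) ∧ (∀ i j, i ≠ j → Tendsto (fun t ↦ ‖ξ i t - ξ j t‖) atTop atTop) ∧ (0 < κ ∧ κ < 1 ∧ ∀ i, ∀ᶠ t in atTop, ‖ξ i t‖ ≤ κ ^ 2 * t) ∧ ({x : E4 | τ₀ < x 0 ∧ ∀ i, rin i < Kerr.radius (a i) (poincareInv (Λ i (x 0)) (E4.ofTimeSpace (x 0) (ξ i (x 0))) x)} ⊆ (U : Set E4)) ∧ let B : ModelBackground := ⟨U, fun x ↦ Minkowski.bilin + ∑ i, (boostedKerrBilin (Λ i (x 0)) (E4.ofTimeSpace (x 0) (ξ i (x 0))) (M i) (a i) x - Minkowski.bilin), fun x ↦ x 0, E4.spatialNorm⟩; ContMDiff 𝓘(ℝ, E4) (𝓡 4) ((⊤ : ℕ∞) : WithTop ℕ∞) Φ ∧ Topology.IsOpenEmbedding ((B.lateRegion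 τ₀).restrict Φ) ∧ Φ '' {x : U | τ₀ < x.1 0 ∧ ∀ i, Kerr.rPlus (M i) (a i) < Kerr.radius (a i) (poincareInv (Λ i (x.1 0)) (E4.ofTimeSpace (x.1 0) (ξ i (x.1 0))) x.1)} ⊆ O ∧ Tendsto (fun t ↦ 𝒟.toSpacetime.deviationCk B Φ 3 t) atTop (𝓝 0) ∧ Tendsto (fun t : ℝ ↦ ⨆ x ∈ {x : U | x.1 0 = t ∧ E4.spatialNorm x.1 ≤ κ * t}, ⨆ (m : ℕ) (_ : m ≤ 3), ENNReal.ofReal (1 + √(√((⨅ i, ‖E4.spatial x.1 - ξ i t‖) ^ 7))) * ‖iteratedFDeriv ℝ m (𝒟.toSpacetime.deviationExtend B Φ) x.1‖ₑ) atTop (𝓝 0) ∧ O = Summit.FinalStateConjecture.exteriorOf 𝒟.toCauchyDevelopment (Φ '' {x : U | τ₀ < x.1 0 ∧ ∀ i, Kerr.rPlus (M i) (a i) < Kerr.radius (a i) (poincareInv (Λ i (x.1 0)) (E4.ofTimeSpace (x.1 0) (ξ i (x.1 0))) x.1)}) ∧ (∀ t₁ : ℝ, τ₀ < t₁ → O \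 Φ '' {x : U | t₁ < x.1 0 ∧ ∀ i, Kerr.rPlus (M i) (a i) < Kerr.radius (a i) (poincareInv (Λ i (x.1 0)) (E4.ofTimeSpace (x.1 0) (ξ i (x.1 0))) x.1)} ⊆ 𝒟.metric.causalPast 𝒟.timeOrientation (Φ '' {x : U | x.1 0 = t₁ ∧ ∀ i, Kerr.rPlus (M i) (a i) < Kerr.radius (a i) (poincareInv (Λ i (x.1 0)) (E4.ofTimeSpace (x.1 0) (ξ i (x.1 0))) x.1)})) ∧ (∃ τ₁ : ℝ, ∀ x y : U, (τ₁ < x.1 0 ∧ ∀ i, rin i < Kerr.radius (a i) (poincareInv (Λ i (x.1 0)) (E4.ofTimeSpace (x.1 0) (ξ i (x.1 0))) x.1)) → (τ₁ < y.1 0 ∧ ∀ i, rin i < Kerr.radius (a i) (poincareInv (Λ i (y.1 0)) (E4.ofTimeSpace (y.1 0) (ξ i (y.1 0))) y.1)) → Φ y ∈ 𝒟.metric.causalFuture 𝒟.timeOrientation {Φ x} → x.1 0 ≤ y.1 0) ∧ (∀ (i : Fin N) (t : ℝ), 0 < (((Λ i t : lorentzGroup) : E4 ≃L[ℝ] E4)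 (E4.basisVector 0)) 0) ∧ Summit.FinalStateConjecture.RaysStayInClosure 𝒟.toCauchyDevelopment O ∧ (∀ ρ : ℝ → ℝ, Tendsto ρ atTop atTop → Tendsto (fun t : ℝ ↦ ⨆ x ∈ {x : E4 | x 0 = t ∧ E4.spatialNorm x ≤ κ * t ∧ ρ t ≤ ⨅ i, ‖E4.spatial x - ξ i t‖}, ENNReal.ofReal (1 + √(√((⨅ i, ‖E4.spatial x - ξ i t‖) ^ 7))) * ‖fderiv ℝ (fun y : E4 ↦ Minkowski.bilin + ∑ i, (boostedKerrBilin (Λ i (y 0)) (E4.ofTimeSpace (y 0) (ξ i (y 0))) (M i) (a i) y - Minkowski.bilin)) x (E4.basisVector 0)‖ₑ) atTop (𝓝 0)))) 1 :=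
  modulatedKerrHandoff_of_trim_kick hT hW hK


/-! ### The registered stubs (= the route children) and the composition concluding the crux BY NAME -/

/-- **STUB T — `TameEndTrimming`** (constraint gluing; tame receding end trimming of every admissible
datum on its sole DR end). [cite: CorvinoSchoen2006, Thm 1] -/
theorem stub_tameEndTrimming :
    open Literature.Geometry.Lorentzian in ∀ (X : Type) [TopologicalSpace X] [ChartedSpace E3 X] [IsManifold (𝓡 3) ((⊤ : ℕ∞) : WithTop ℕ∞) X] [T2Space X] [SecondCountableTopology X] [ConnectedSpace X], ∀ d ∈ admissibleVacuumData X, ∀ (e : AFEnd X) (M₀ : ℝ), e.IsSoleEnd → e.IsStronglyAsymptoticallyFlatDR d M₀ → ∃ (R₀ : ℝ) (T : ℝ → InitialDataSet (𝓡 3) X) (M : ℝ → ℝ), ((∀ R, R₀ ≤ R → T R ∈ admissibleVacuumData X ∧ (∃ Mt : ℝ, e.IsStronglyAsymptoticallyFlatWith (T R) Mt (15 / 8) (23 / 8) 4 3) ∧ e.IsStronglyAsymptoticallyFlatDR (T R) (M R) ∧ ∀ x ∉ e.far R, (T R).h.inner x = d.h.inner x ∧ (T R).k x = d.k x) ∧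 (∀ ρ : EuclideanSpace ℝ (Fin 1) → ℝ, ContDiff ℝ ((⊤ : ℕ∞) : WithTop ℕ∞) ρ → (∀ c, R₀ ≤ ρ c) → InitialDataSet.IsSmoothDataFamily 1 (fun c ↦ T (ρ c))) ∧ ContinuousOn M (Set.Ici R₀) ∧ Tendsto M atTop (𝓝 M₀) ∧ Tendsto (fun R ↦ e.wDist (T R) d) atTop (𝓝 0)) := by
  sorry

/-- **STUB W — `KickCensorship`** (weak cosmic censorship, Christodoulou's local one-sided kick form).
[cite: Christodoulou1999, p. A24] -/
theorem stub_kickCensorship :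
    open Literature.Geometry.Lorentzian in ∀ (X : Type) [TopologicalSpace X] [ChartedSpace E3 X] [IsManifold (𝓡 3) ((⊤ : ℕ∞) : WithTop ℕ∞) X] [T2Space X] [SecondCountableTopology X] [ConnectedSpace X], ∀ d ∈ admissibleVacuumData X, (¬ ∀ 𝒟 : VacuumCauchyDevelopment d, 𝒟.IsMaximal → Summit.FinalStateConjecture.HasCompleteNullInfinity 𝒟.toCauchyDevelopment) → ∃ G : EuclideanSpace ℝ (Fin 1) → InitialDataSet (𝓡 3) X, (InitialDataSet.IsSmoothDataFamily 1 G ∧ G 0 = d ∧ (∀ c, G c ∈ admissibleVacuumData X) ∧ ∃ K : Set X, IsCompact K ∧ ∀ c, ∀ x ∉ K, (G c).h.inner x = d.h.inner x ∧ (G c).k x = d.k x) ∧ ∃ δ : ℝ, 0 < δ ∧ ∀ c : EuclideanSpace ℝ (Fin 1), 0 < c 0 → c 0 < δ → ∀ 𝒟 : VacuumCauchyDevelopment (G c), 𝒟.IsMaximal → Summit.FinalStateConjecture.HasCompleteNullInfinity 𝒟.toCauchyDevelopment := by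
  sorry

/-- **STUB K — `CensoredKickHandoff`** (capture + far-surgery stability + format synthesis for
censored kick lines, Kerr/harmonic-ended by trimming; pointwise in the patched datum).
[cite: DafermosLuk2017, Conjecture 1] -/
theorem stub_censoredKickHandoff :
    open Literature.Geometry.Lorentzian in ∀ (X : Type) [TopologicalSpace X] [ChartedSpace E3 X] [IsManifold (𝓡 3) ((⊤ : ℕ∞) : WithTop ℕ∞) X] [T2Space X] [SecondCountableTopology X] [ConnectedSpace X], ∀ d ∈ admissibleVacuumData X, ¬ Summit.FinalStateConjecture.FinalStateConjecture.Theorems.EIHFluxBalance.TameTemplate.HandoffPropT X d → ∀ (G₁ : EuclideanSpace ℝ (Fin 1) → InitialDataSet (𝓡 3) X) (δ₁ : ℝ), (InitialDataSet.IsSmoothDataFamily 1 G₁ ∧ G₁ 0 = d ∧ (∀ c, G₁ c ∈ admissibleVacuumData X) ∧ ∃ K : Set X, IsCompact K ∧ ∀ c, ∀ x ∉ K, (G₁ c).h.inner x = d.h.inner x ∧ (G₁ c).k x = d.k x) → 0 < δ₁ → (∀ c : EuclideanSpace ℝ (Fin 1), 0 < c 0 → c 0 < δ₁ → ∀ 𝒟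 : VacuumCauchyDevelopment (G₁ c), 𝒟.IsMaximal → Summit.FinalStateConjecture.HasCompleteNullInfinity 𝒟.toCauchyDevelopment) → ∀ (e : AFEnd X) (M₀ R₀ : ℝ) (T : ℝ → InitialDataSet (𝓡 3) X) (M : ℝ → ℝ), e.IsSoleEnd → e.IsStronglyAsymptoticallyFlatDR d M₀ → ((∀ R, R₀ ≤ R → T R ∈ admissibleVacuumData X ∧ (∃ Mt : ℝ, e.IsStronglyAsymptoticallyFlatWith (T R) Mt (15 / 8) (23 / 8) 4 3) ∧ e.IsStronglyAsymptoticallyFlatDR (T R) (M R) ∧ ∀ x ∉ e.far R, (T R).h.inner x = d.h.inner x ∧ (T R).k x = d.k x) ∧ (∀ ρ : EuclideanSpace ℝ (Fin 1) → ℝ, ContDiff ℝ ((⊤ : ℕ∞) : WithTop ℕ∞) ρ → (∀ c, R₀ ≤ ρ c) → InitialDataSet.IsSmoothDataFamily 1 (fun c ↦ T (ρ c))) ∧ ContinuousOn M (Set.Ici R₀) ∧ Tendsto M atTop (𝓝 M₀) ∧ Tendsto (fun R ↦ e.wDist (T R) d) atTop (𝓝 0)) → ∃ G : EuclideanSpace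 ℝ (Fin 1) → InitialDataSet (𝓡 3) X, (InitialDataSet.IsSmoothDataFamily 1 G ∧ G 0 = d ∧ (∀ c, G c ∈ admissibleVacuumData X) ∧ ∃ K : Set X, IsCompact K ∧ ∀ c, ∀ x ∉ K, (G c).h.inner x = d.h.inner x ∧ (G c).k x = d.k x) ∧ ∃ (δ : ℝ) (ρ₁ : ℝ → ℝ), 0 < δ ∧ (∀ a b : ℝ, 0 < a → a ≤ b → b < δ → BddAbove (ρ₁ '' Set.Icc a b)) ∧ ∀ c : EuclideanSpace ℝ (Fin 1), 0 < c 0 → c 0 < δ → ∀ R : ℝ, R₀ ≤ R → ρ₁ (c 0) ≤ R → ∀ D' ∈ admissibleVacuumData X, (∀ x ∉ e.far R, D'.h.inner x = (G c).h.inner x ∧ D'.k x = (G c).k x) → (∀ x ∈ e.far R, D'.h.inner x = (T R).h.inner x ∧ D'.k x = (T R).k x) → ∃ 𝒟 : VacuumCauchyDevelopment D', 𝒟.IsMaximal ∧ Summit.FinalStateConjecture.FinalStateConjecture.Theorems.EIHFluxBalance.TameTemplate.HandoffClause X D' 𝒟 := by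
  sorry

/-- **COMPOSITION.** `ModulatedKerrHandoff` from the three stubs (the crux BY NAME; the route decl
`δ`-unfolds to the verbatim body concluded by `modulatedKerrHandoff_of_trim_kick_inlined`). -/
theorem ModulatedKerrHandoff_of : ModulatedKerrHandoff :=
  modulatedKerrHandoff_of_trim_kick_inlined stub_tameEndTrimming stub_kickCensorship
    stub_censoredKickHandoff

end Summit.FinalStateConjecture.FinalStateConjecture.Cruxes.ModulatedKerrHandoff.TrimKickCensorship

end
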